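import Summits.BirchSwinnertonDyer.BirchSwinnertonDyer.Theorems.ByReductionTypeAtTwoRankOneAtTwoBigImageOddLocalOneDoorTranspositionParity
import Summits.BirchSwinnertonDyer.Rank1Residual.Supersingular.TamagawaParitySquare
import HarnessLib

/-!
# Route ByReductionTypeAtTwo, crux `RankOneAtTwoBigImageOddLocal` (stmt-BirchSwinnertonDyer-23715), line `one_door_analytic`:
# AN-14G₁ `TamOddSquareLaw` and AN-14G `AdmissiblePrincipalGenusLaw` PROVED

Lead prover seat `bsd-line-fkl-p1` g19 (2026-08-29).  THEOREMS ONLY (standard axioms; no `def`, no named fact, no `sorry`, nothing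
conditional).  Helper file `--supports stmt-BirchSwinnertonDyer-23715`; it does not close the crux and BSD is not proved by any of this.

* `tamOddSquareLaw_holds : F1Sign2.EggSymbol.TamOddSquareLaw` — AN-14G₁ (-an g5, `EggSymbolGenusAtTwo.lean`; REF1 §31 «support-grade,
  elementary from Ogg–Saito + the Kodaira–Néron table», census 3 260 / 3 260): for a globally minimal elliptic `W/ℚ` with `Δ_W > 0` and
  `∏ c_ℓ` odd, `N_W · Δ_W` is a perfect square.  It is READ OFF the tree's Tamagawa-parity square lemma of the `b2b` cell
  (`Rank1Residual.Supersingular.exists_conductorNorm_mul_abs_minimalDiscriminantInt_eq_sq`: `Tam(E)` odd ⇒ `N_E · |Δ_min| = m²`,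
  itself assembled from the tree's DISCHARGED Tate-algorithm table and Ogg's formula, by which the tree defines the conductor exponent)
  through `W.Δ.num = Δ_min` (`ArchReciprocity.num_Δ_eq_minimalDiscriminantInt`) and `|Δ_min| = Δ_min` at `Δ_W > 0`.
* `admissiblePrincipalGenusLaw_holds : F1Sign2.EggSymbol.AdmissiblePrincipalGenusLaw` — AN-14G, the genus law behind -an's egg symbol
  (`Δ_W > 0`, `∏ c_ℓ` odd, `d` descent-admissible ⇒ `(N_W / q) = +1` at every prime `q ∣ d`; census 2 301 / 2 301): g18's
  `admissiblePrincipalGenusLaw_of_tamOddSquareLaw` (G₂ `OddTraceSquareResidueLaw` already discharged there) with G₁ discharged here.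

Bears on the `Δ_W > 0` population of the crux (the egg / non-egg split of the first Kolyvagin layer, stubs R₀⁺ / R_N of the line of
record v8.17): both -an support laws of the egg-symbol packet AN-14 are now tree theorems, so every statement of the cell proved
«modulo AN-14G» is unconditional.
-/

set_option autoImplicit false
set_option linter.dupNamespace false

noncomputable section

open scoped Classical

namespace Summit.BirchSwinnertonDyer.BirchSwinnertonDyer.Theorems.RankOneAtTwoOneDoor

open WeierstrassCurve
open Summit.BirchSwinnertonDyer.Rank1Residual.F1Sign2
open Summit.BirchSwinnertonDyer.Rank1Residual.F1Sign2.EggSymbol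
open Summit.BirchSwinnertonDyer.Rank1Residual.F1Sign2.ArchReciprocity
open Summit.BirchSwinnertonDyer.Rank1Residual.Supersingular

/-- **AN-14G₁ `TamOddSquareLaw` PROVED**: for a globally minimal elliptic `W/ℚ` with `Δ_W > 0` and odd Tamagawa product, `N_W · Δ_W` is a
perfect square (`Tam` odd ⇒ every `c_ℓ` odd ⇒ every Kodaira fibre has an odd number `m_ℓ` of components ⇒ `f_ℓ + ord_ℓ Δ = 2 ord_ℓ Δ + 1 − m_ℓ`
is even, Ogg's formula; the tree's `exists_conductorNorm_mul_abs_minimalDiscriminantInt_eq_sq`).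
[cite: SilvermanATAEC1994, IV.9.4 Table 4.1 and IV.11.1] -/
theorem tamOddSquareLaw_holds : TamOddSquareLaw := by
  intro W _ _ hΔ h2
  have hodd : Odd W.tamagawaProduct := Nat.odd_iff.mpr (Nat.two_dvd_ne_zero.mp h2)
  obtain ⟨m, hm⟩ := exists_conductorNorm_mul_abs_minimalDiscriminantInt_eq_sq W hodd
  have hpos : 0 < minimalDiscriminantInt W := by
    have h : (0 : ℚ) < (minimalDiscriminantInt W : ℚ) := by rwa [cast_minimalDiscriminantInt]
    exact_mod_cast h
  rw [num_Δ_eq_minimalDiscriminantInt, ← abs_of_pos hpos, hm, sq]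
  exact ⟨m, rfl⟩

/-- **AN-14G `AdmissiblePrincipalGenusLaw` PROVED**: `Δ_W > 0`, `∏ c_ℓ` odd and `d` descent-admissible ⇒ `(N_W / q) = +1` for every prime
`q ∣ d` (the class of `𝔫` is a square in `Cl(ℚ(√d))`): g18's `admissiblePrincipalGenusLaw_of_tamOddSquareLaw` ∘ `tamOddSquareLaw_holds`. -/
theorem admissiblePrincipalGenusLaw_holds : AdmissiblePrincipalGenusLaw :=
  admissiblePrincipalGenusLaw_of_tamOddSquareLaw tamOddSquareLaw_holds

end Summit.BirchSwinnertonDyer.BirchSwinnertonDyer.Theorems.RankOneAtTwoOneDoor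

end
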